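import Summits.AtomisticToContinuum.Crystallization.Theses.PalmUnimodularRigidity
import Summits.AtomisticToContinuum.Crystallization.Theorems.MinimiserShells.Negative.LoadBearing
import Summits.AtomisticToContinuum.Crystallization.Theorems.MinimiserShells.Negative.Rootedness
import Literature.Probability.Process.PointStationaryLaw
import Literature.MathematicalPhysics.StatisticalMechanics.RootEnergy
import Literature.MathematicalPhysics.StatisticalMechanics.MuGSC

/-!
# Energy floor `e_uni ≥ e*` (route item 9229 `UnimodularEnergyLowerBound`): DEFINITIONS of the
# random-grid mass transport

Support file for stub `stub_energyFloor` (S2) of line `equilibrium-in-law-surgery` of crux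
`MinimiserShells` (stmt-AtomisticToContinuum-9225), which discharges route item
stmt-AtomisticToContinuum-9229 `UnimodularEnergyLowerBound` ("e_uni ≥ e*": every point-stationary
hard-core probability law on rooted configurations of `ℝ³` has mean root energy `E_P[h] ≥ e*`).

The proof is a RANDOM-GRID MASS TRANSPORT: the cubic grid of mesh `L` with a uniformly distributed
phase cuts the configuration into finite clusters; the root sends its local energy (plus a constant)
in equal shares to the points of its own cell; the Mecke identity equates the mean mass sent with
the mean mass received, and the mass received by the root is the energy per particle of a finite
cluster, `≥ e*` by periodisation (`card_mul_eStar_le`); the boundary error vanishes as `L → ∞`.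
This file holds ALL the definitions of the construction (the lemma files `…EnergyFloorA–E` and the
theorem file `…EnergyFloor` are pure proofs):

* `cellIdx L v z ∈ ℤ³` — index of the cell of the grid `L • (v + ℤ³ + [0,1)³)` containing `z`;
  `rootCell L v = {z | cellIdx L v z = cellIdx L v 0}`, the root's cell;
* `stdBasis`, `unitLattice = ℤ³`, `phaseDom = [0,1)³` (its `ZSpan` fundamental domain, the phase
  space), `phaseOut L z` = volume of phases putting `z` outside the root's cell;
* `packBound`, `hcClass δ` — configurations with the packing bounds `μ(B̄(0,n)) ≤ (2n/δ+1)³`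
  (measurable; contains every `δ`-hard-core configuration), `trunc δ` (truncation to the class) and
  the **truncated configuration kernel** `truncKernel δ : Kernel (Measure ℝ³) ℝ³`, S-FINITE
  (`isSFiniteKernel_truncKernel`, decomposition along the norm shells `normShell n`) — the
  measurability engine making phase-dependent configuration sums jointly measurable;
* `rootEnergy' μ = ½ ((∫⁻ V⁺ dμ).toReal − (∫⁻ V⁻ dμ).toReal)` — Giry-measurable root energy;
* `cst δ = 250/12 · δ⁻⁶`; `locPos`, `locNeg`, `locEnergy δ μ A = ½ ∑_{z ∈ A} V_LJ(‖z‖)` (local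
  energy over a set, through the truncated configuration), `share δ μ A = (locEnergy + C_δ)/#A`,
  and the **transport** `transport δ L μ y = ∫_{[0,1)³} 1[y ∈ rootCell L v] · share δ μ (rootCell L v) dv`;
* `errTerm L μ = ∑_{z ∈ μ} ‖z‖⁻⁶ · phaseOut L z` — the boundary error functional.
-/

noncomputable section

open MeasureTheory ProbabilityTheory
open scoped ENNReal BigOperators

namespace Summit.AtomisticToContinuum.Crystallization.Theorems.PalmUnimodularRigidityMinimiserShells.EnergyFloor

open Literature.MathematicalPhysics.StatisticalMechanics (lennardJones)

/-! ## The phased cubic grid -/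

/-- **Cell index** of the point `z` in the cubic grid of mesh `L` and phase `v` (in units of `L`):
`z` lies in the half-open cell `L • (v + k + [0,1)³)` with `k_i = ⌊z_i / L - v_i⌋`. -/
def cellIdx (L : ℝ) (v z : EuclideanSpace ℝ (Fin 3)) : Fin 3 → ℤ :=
  fun i => ⌊z i / L - v i⌋

/-- The root's cell at phase `v`: the points `z` with `cellIdx L v z = cellIdx L v 0`. -/
def rootCell (L : ℝ) (v : EuclideanSpace ℝ (Fin 3)) : Set (EuclideanSpace ℝ (Fin 3)) :=
  {z | cellIdx L v z = cellIdx L v 0}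

/-! ## The unit lattice `ℤ³` and the phase domain `[0,1)³` -/

/-- The standard basis of `ℝ³` (as a `Module.Basis`). -/
def stdBasis : Module.Basis (Fin 3) ℝ (EuclideanSpace ℝ (Fin 3)) :=
  (EuclideanSpace.basisFun (Fin 3) ℝ).toBasis

/-- The unit cubic lattice `ℤ³ ⊂ ℝ³` (the additive subgroup spanned by the standard basis). -/
def unitLattice : AddSubgroup (EuclideanSpace ℝ (Fin 3)) :=
  (Submodule.span ℤ (Set.range stdBasis)).toAddSubgroup

/-- `ℤ³` is countable. -/
instance countable_unitLattice : Countable unitLattice :=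
  inferInstanceAs (Countable (Submodule.span ℤ (Set.range stdBasis)))

/-- The phase domain `[0,1)³`, the `ZSpan` fundamental domain of the standard basis. -/
def phaseDom : Set (EuclideanSpace ℝ (Fin 3)) := ZSpan.fundamentalDomain stdBasis

/-- **Boundary phases of a point**: the volume of phases `v ∈ [0,1)³` for which the fixed point
`z` is NOT in the root's cell of the grid of mesh `L`. -/
def phaseOut (L : ℝ) (z : EuclideanSpace ℝ (Fin 3)) : ℝ≥0∞ :=
  (volume : Measure (EuclideanSpace ℝ (Fin 3))).restrict phaseDom
    {v | cellIdx L v z ≠ cellIdx L v 0}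

/-! ## The packing class and the truncated configuration kernel -/

section Trunc

variable {δ : ℝ}

/-- The packing bound `(2n/δ+1)³` as an extended non-negative real. -/
def packBound (δ : ℝ) (n : ℕ) : ℝ≥0∞ := ENNReal.ofReal ((2 * n / δ + 1) ^ 3)

/-- **The uniformly locally finite class**: configurations `μ` with `μ(B̄(0,n)) ≤ (2n/δ+1)³` for
every `n ∈ ℕ`. -/
def hcClass (δ : ℝ) : Set (Measure (EuclideanSpace ℝ (Fin 3))) :=
  {μ | ∀ n : ℕ, μ (Metric.closedBall 0 n) ≤ packBound δ n}

/-- The class `hcClass δ` is measurable in the Giry σ-algebra. -/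
theorem measurableSet_hcClass (δ : ℝ) : MeasurableSet (hcClass δ) := by
  have h : hcClass δ = ⋂ n : ℕ, {μ : Measure (EuclideanSpace ℝ (Fin 3)) |
      μ (Metric.closedBall 0 n) ≤ packBound δ n} := by
    ext μ
    simp [hcClass]
  rw [h]
  exact MeasurableSet.iInter fun n =>
    (Measure.measurable_coe measurableSet_closedBall) measurableSet_Iic

open Classical in
/-- Truncation to the class: `trunc δ μ = μ` if `μ ∈ hcClass δ`, else the zero measure. -/
def trunc (δ : ℝ) (μ : Measure (EuclideanSpace ℝ (Fin 3))) : Measure (EuclideanSpace ℝ (Fin 3)) :=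
  if μ ∈ hcClass δ then μ else 0

/-- On the class, truncation does nothing. -/
theorem trunc_of_mem {μ : Measure (EuclideanSpace ℝ (Fin 3))} (h : μ ∈ hcClass δ) : trunc δ μ = μ := by
  simp [trunc, h]

/-- Off the class, truncation gives the zero measure. -/
theorem trunc_of_not_mem {μ : Measure (EuclideanSpace ℝ (Fin 3))} (h : μ ∉ hcClass δ) :
    trunc δ μ = 0 := by
  simp [trunc, h]

/-- Truncated configurations are in the class or zero; either way they satisfy the packing bounds. -/
theorem trunc_closedBall_le (δ : ℝ) (μ : Measure (EuclideanSpace ℝ (Fin 3))) (n : ℕ) :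
    trunc δ μ (Metric.closedBall 0 n) ≤ packBound δ n := by
  by_cases h : μ ∈ hcClass δ
  · rw [trunc_of_mem h]; exact h n
  · rw [trunc_of_not_mem h]; simp

/-- Evaluations of the truncation are measurable. -/
theorem measurable_trunc_coe {A : Set (EuclideanSpace ℝ (Fin 3))} (hA : MeasurableSet A) :
    Measurable fun μ : Measure (EuclideanSpace ℝ (Fin 3)) => trunc δ μ A := by
  classical
  have h : (fun μ : Measure (EuclideanSpace ℝ (Fin 3)) => trunc δ μ A) =
      fun μ => if μ ∈ hcClass δ then μ A else 0 := by
    funext μ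
    by_cases hμ : μ ∈ hcClass δ
    · rw [trunc_of_mem hμ, if_pos hμ]
    · rw [trunc_of_not_mem hμ, if_neg hμ, Measure.coe_zero, Pi.zero_apply]
  rw [h]
  exact Measurable.ite (measurableSet_hcClass δ) (Measure.measurable_coe hA) measurable_const

/-- Truncation is a measurable map of measures. -/
theorem measurable_trunc (δ : ℝ) : Measurable (trunc δ) :=
  Measure.measurable_of_measurable_coe _ fun _ hA => measurable_trunc_coe hA

/-- **The truncated configuration kernel** `μ ↦ trunc δ μ`. -/
def truncKernel (δ : ℝ) : Kernel (Measure (EuclideanSpace ℝ (Fin 3))) (EuclideanSpace ℝ (Fin 3)) where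
  toFun := trunc δ
  measurable' := measurable_trunc δ

/-- The truncated kernel evaluates to `trunc`. -/
@[simp] theorem truncKernel_apply (δ : ℝ) (μ : Measure (EuclideanSpace ℝ (Fin 3))) :
    truncKernel δ μ = trunc δ μ := rfl

/-- The norm shells `{⌊‖z‖⌋ = n}`. -/
def normShell (n : ℕ) : Set (EuclideanSpace ℝ (Fin 3)) := {z | ⌊‖z‖⌋₊ = n}

/-- Norm shells are measurable. -/
theorem measurableSet_normShell (n : ℕ) : MeasurableSet (normShell n) :=
  (Nat.measurable_floor.comp measurable_norm) (measurableSet_singleton n)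

/-- The `n`-th shell lies in the closed ball of radius `n+1`. -/
theorem normShell_subset (n : ℕ) : normShell n ⊆ Metric.closedBall 0 ((n + 1 : ℕ) : ℝ) := by
  intro z hz
  rw [Metric.mem_closedBall, dist_zero_right]
  have h : ⌊‖z‖⌋₊ = n := hz
  have := Nat.lt_floor_add_one ‖z‖
  rw [h] at this
  push_cast
  linarith

/-- **The truncated kernel is s-finite** (restrict to the norm shells: each restriction is a finite
kernel by the packing bounds, and the shells partition `ℝ³`). -/
instance isSFiniteKernel_truncKernel (δ : ℝ) : IsSFiniteKernel (truncKernel δ) := by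
  have hdisj : Pairwise (Function.onFun Disjoint normShell) := fun m n hmn =>
    Set.disjoint_left.2 fun z (hz : ⌊‖z‖⌋₊ = m) (hz' : ⌊‖z‖⌋₊ = n) => hmn (hz.symm.trans hz')
  have hunion : (⋃ n, normShell n) = Set.univ :=
    Set.iUnion_eq_univ_iff.2 fun z => ⟨⌊‖z‖⌋₊, rfl⟩
  refine ⟨⟨fun n => (truncKernel δ).restrict (measurableSet_normShell n), fun n => ?_, ?_⟩⟩
  · refine ⟨⟨packBound δ (n + 1), ENNReal.ofReal_lt_top, fun μ => ?_⟩⟩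
    rw [Kernel.restrict_apply' _ _ _ MeasurableSet.univ, Set.univ_inter, truncKernel_apply]
    exact (measure_mono (normShell_subset n)).trans (trunc_closedBall_le δ μ (n + 1))
  · refine Kernel.ext fun μ => ?_
    rw [Kernel.sum_apply]
    simp_rw [Kernel.restrict_apply]
    rw [← Measure.restrict_iUnion hdisj measurableSet_normShell, hunion, Measure.restrict_univ]

end Trunc

/-! ## The measurable root energy -/

/-- **Measurable root energy** `h'(μ) = ½ ((∫⁻ V⁺).toReal − (∫⁻ V⁻).toReal)`, defined for every
measure and equal to the Bochner root energy `½ ∫ V_LJ(‖y‖) dμ` on hard-core configurations. -/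
def rootEnergy' (μ : Measure (EuclideanSpace ℝ (Fin 3))) : ℝ :=
  ((∫⁻ y, ENNReal.ofReal (lennardJones ‖y‖) ∂μ).toReal -
    (∫⁻ y, ENNReal.ofReal (-lennardJones ‖y‖) ∂μ).toReal) / 2

/-! ## The transport -/

/-- The transported constant `C_δ = 250/12 · δ⁻⁶`: it dominates minus every local Lennard-Jones
energy of a rooted `δ`-hard-core configuration (`V_LJ ≥ -r⁻⁶/6` and the shell bound
`∑ ‖z‖⁻⁶ ≤ 250 δ⁻⁶`), so that the transported mass `local energy + C_δ` is non-negative. -/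
def cst (δ : ℝ) : ℝ := 250 / 12 * δ⁻¹ ^ 6

/-- Positive local Lennard-Jones sum of the (truncated) configuration over the set `A`. -/
def locPos (δ : ℝ) (μ : Measure (EuclideanSpace ℝ (Fin 3))) (A : Set (EuclideanSpace ℝ (Fin 3))) :
    ℝ≥0∞ :=
  ∫⁻ z, A.indicator (fun z => ENNReal.ofReal (lennardJones ‖z‖)) z ∂(trunc δ μ)

/-- Negative local Lennard-Jones sum of the (truncated) configuration over the set `A`. -/
def locNeg (δ : ℝ) (μ : Measure (EuclideanSpace ℝ (Fin 3))) (A : Set (EuclideanSpace ℝ (Fin 3))) :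
    ℝ≥0∞ :=
  ∫⁻ z, A.indicator (fun z => ENNReal.ofReal (-lennardJones ‖z‖)) z ∂(trunc δ μ)

/-- **Local energy** of the root restricted to the set `A`: `½ ∑_{z ∈ A} V_LJ(‖z‖)` (through
positive and negative parts of the truncated configuration, so defined for every measure). -/
def locEnergy (δ : ℝ) (μ : Measure (EuclideanSpace ℝ (Fin 3))) (A : Set (EuclideanSpace ℝ (Fin 3))) :
    ℝ :=
  ((locPos δ μ A).toReal - (locNeg δ μ A).toReal) / 2

/-- **The share** sent by the root to each point of the set `A` (its cell):
`(locEnergy + C_δ) / #(points in A)`. -/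
def share (δ : ℝ) (μ : Measure (EuclideanSpace ℝ (Fin 3))) (A : Set (EuclideanSpace ℝ (Fin 3))) :
    ℝ≥0∞ :=
  ENNReal.ofReal (locEnergy δ μ A + cst δ) / trunc δ μ A

/-- **The random-grid transport** `g(μ, y)`: the phase average of the share the root sends to `y`,
`∫_{[0,1)³} 1[y ∈ rootCell L v] · share(μ, rootCell L v) dv`. -/
def transport (δ L : ℝ) (μ : Measure (EuclideanSpace ℝ (Fin 3))) (y : EuclideanSpace ℝ (Fin 3)) :
    ℝ≥0∞ :=
  ∫⁻ v in phaseDom, (rootCell L v).indicator (fun _ => share δ μ (rootCell L v)) y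

/-! ## The boundary error functional -/

/-- **The boundary error functional** `err_L(μ) = ∑_{z ∈ μ} ‖z‖⁻⁶ · vol{phases putting z outside
the root's cell}`. -/
def errTerm (L : ℝ) (μ : Measure (EuclideanSpace ℝ (Fin 3))) : ℝ≥0∞ :=
  ∫⁻ z, ENNReal.ofReal (‖z‖⁻¹ ^ 6) * phaseOut L z ∂μ

end Summit.AtomisticToContinuum.Crystallization.Theorems.PalmUnimodularRigidityMinimiserShells.EnergyFloor

end
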